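import Summits.QuantumFields.BalabanUV.Beta.D1BFx.SortedPack
import Summits.QuantumFields.BalabanUV.Beta.ChartConjugationRelative
import Summits.QuantumFields.BalabanUV.Beta.RelInvBorderedHessian
import Summits.QuantumFields.BalabanUV.Beta.BubbleParity

/-!
# `BalabanUV.Beta.D1BFx.SortedRelInv` — road «BF-x», binder row D1, slot (K), debt X₃(ii) ROUTE T, brick **TB1 «M-SIDE ON THE TORUS»** PART 1
# (generic): THE FOUR RELATIVE-INVERSE RULES OF PACKED `ℤ^D` KERNELS PERIODISE TO THE FOUR MATRIX RULES ON EVERY COARSE TORUS —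
# `RelInv A 𝕄 E` (an2's `ChartConjugationRelative.RelInv`: `E∘A = A = A∘E`, `(A∘𝕄)∘E = E = (E∘𝕄)∘A`) for spread, block-covariant packs with
# multiplier legs on the coarse sublattice ⟹ `Ê·Â = Â`, `Â·Ê = Â`, `Â·𝕄̂·Ê = Ê`, `Ê·𝕄̂·Â = Ê` for the periodised SORTED kernels (`SortedPack.sortK`,
# TA1) over `Site D p × (((ℤ∕n)^D × F) ⊕ F)`, every coarse period `p`

WHY (K-ASSEMBLY-SPEC v1 §1 TB1; question TB1-Q answered by the row-D1 owner an2-g23's `RelInvCombBorderedKKT`: on a finite index the four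
rules w.r.t. a coordinate projector `E = fromBlocks (1 − τᵀτ) 0 0 1` are EQUIVALENT to «`kkt K (fromRows Q τ)` is invertible with the dressed pack
as the `(ν ⊕ μ)`-corner of its inverse» — `isUnit_det_kkt_fromRows_of_relInv`, `blocks_kkt_fromRows_of_relInv`).  The `ℤ⁴` rules are IN THE
TREE for the wall's literal (`RelInvBorderedHessian.relInv_coDressKBmAt_KInv`: `G := coDressKBmAt ρ n (KInv n)`, `𝕄 := bhK n`, `E := axEc ρ n`).
THIS FILE carries the rules to the torus, generically; PART 2 (`TorusCombKKT`) identifies `Ê` with `fromBlocks (1 − τ_Tᵀτ_T) 0 0 1` for the torus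
comb functional and `𝕄̂` with `kkt K̂ Q̂·diag(1, −1)` and concludes with an2-g23's theorem.
CONTENT (all [folklore]; generic `D`, `F`, block side `n ≥ 1`, coarse period `p ≥ 1`):
* §1 hypotheses packaging: a pack is ADMISSIBLE (`Spr`, block covariant `shiftK (n•t) K = K`, multiplier rows AND columns `0` off `n•ℤ^D`) —
  carried as explicit hypotheses, no structure; [folklore] `spr_decays_pos` (a `Spr` kernel `Decays` at a positive rate), the three
  `periodiseF_compF_matrix` hypotheses for `sortK n K` of an admissible pack (`hyp_rows`, `hyp_per`, `hyp_bound`).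
* §2 **`periodise_sortK_comp`**: `(sortK n (A ∘ K))^ = (sortK n A)^ · (sortK n K)^` as matrices over `Site D p × (((ℤ∕n)^D × F) ⊕ F)` for
  admissible `A`, `K`; **`periodise_sortK_comp₃`** for a triple product.
* §3 **`torus_relInv_rules`**: `RelInv A 𝕄 E` ⟹ the four matrix rules for `Â := (sortK n A)^`, `𝕄̂`, `Ê`; and the `blocksHat` (= `fromBlocks`,
  `SortedKernels.blocksHat_eq_reindex`) form **`torus_relInv_rules_blocks`**.
* §4 THE WALL'S TRIPLE IS ADMISSIBLE: block covariance of the undressed bordered Hessian and of the coarse axial coordinate projector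
  (`shiftK_bhK`, `isCombBondAt_add_zsmul`, `shiftK_axEc`; `axEc_inr_row_off`; `BubbleParity.spr_of_decays` BY NAME), and **`torus_rules_wall`**: the four matrix rules on every coarse
  torus for `(G, bhK n, axEc (toSite r) n)`, `G := coDressKBmAt (toSite r) n (KInvStep n 0)` (an2-g13's `relInv_coDressKBmAt_KInvStep_zero`).
NOT HERE: the identification of `Ê`, `𝕄̂` with the model's `E`, `kkt` (PART 2 `TorusCombKKT`); any road letter; estimates.

HONEST FRAMING (cell contract, verbatim): «discharging `BetaPertH` makes Bałaban's UV stability UNCONDITIONAL — a real constructive-QFT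
result; it is NOT the continuum limit and NOT the Clay problem.»  HONEST DEPENDENCY (verbatim): «continuum YM on T⁴ ⇐ BetaPertH ∧ nine
spine estimates (0/9 proved); BetaPertH ⇐ (D1) ∧ (D4) ∧ CAP+tail; G-an2-4 gates asym, D1 and NE2/3/4.»  [folklore] bookkeeping over TA1
(`SortedKernels`∕`SortedReblocking`∕`SortedPack`), Q1 (`FibredPeriodisation.periodiseF_compF_matrix`) and an2's `ChartConjugationRelative` BY NAME;
no `Prop` is minted, nothing is cited, no wall binder is instantiated; 0 sorry.  NOT D1, NOT BetaPertH, NOT summit progress.  ABSOLUTE RULE (cell,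
verbatim): «No internally-minted statement may enter as a cited fact. Every hypothesis is either kernel-proved in this package or a verbatim
quotation of a PUBLISHED theorem with page reference. The manuscript(s) under audit are NOT citable for their own disputed steps — they are the
thing under adjudication; programme-internal (2001/route/tribunal) claims are never citable.»
Provenance: D1 formalisation swarm, unit `b2b-balaban-beta-d1-formalise-leaf-03` (gen 8), brick «K-TB1» part 1, 2026-08-20.
-/

noncomputable section

namespace Summit.QuantumFields.BalabanUV.Beta.D1BFx.SortedRelInv

open Literature.Probability.LatticeModels (TorusSite Torus.proj Torus.proj_apply)
open Literature.MathematicalPhysics.QuantumFieldTheory.LatticeForm (repZ quo proj_add_zsmul)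
open Literature.MathematicalPhysics.QuantumFieldTheory.Balaban1983to89
open Literature.MathematicalPhysics.QuantumFieldTheory.Balaban1983to89.Beta
open ExpKernelCalculus (MKer Decays comp shiftK Zl)
open AffineAveraging (box toSite unitVec curv curvAdj contourSum)
open AffineReproduction (contourSumAdj)
open KKTFluctuationKernel (delta1 delta1_apply)
open OneStepResolventKernel (Fib)
open OneStepKernelFamily (KInvStep)
open Summit.QuantumFields.BalabanUV.Beta.TameKernelCalculus (Spr Tame Spr.tame decays_of_le)
open Summit.QuantumFields.BalabanUV.Beta.ChartConjugationRelative (RelInv spr_comp)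
open Summit.QuantumFields.BalabanUV.Beta.AxialDressingRooted (cube IsCombBondAt coDressKBmAt axEc axEc_inl_inl axEc_inl_inr axEc_inr_inl
  axEc_inr_inr spr_axEc decays_coDressKBmAt_KInvStep shiftK_coDressKBmAt_KInvStep coDressKBmAt_KInvStep_inr_row_off)
open Summit.QuantumFields.BalabanUV.Beta.BorderedHessian (bhK bhK_inl_inl bhK_inl_inr bhK_inr_inl bhK_inr_inr bhK_inr_row_off spr_bhK
  relInv_coDressKBmAt_KInvStep_zero)
open Summit.QuantumFields.BalabanUV.Beta.BubbleParity (spr_of_decays)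
open Summit.QuantumFields.BalabanUV.Beta.D1BFx.FibredPeriodisation
open Summit.QuantumFields.BalabanUV.Beta.D1BFx.SortedKernels
open Summit.QuantumFields.BalabanUV.Beta.D1BFx.SortedReblocking
open Summit.QuantumFields.BalabanUV.Beta.D1BFx.SortedPack
open scoped BigOperators Matrix

variable {D : ℕ} {F : Type*} {n : ℕ}

/-! ## §1 The hypotheses of the product rule for sorted packs -/

/-- [folklore] A spread kernel decays at some POSITIVE rate with a nonnegative constant. -/
theorem spr_decays_pos {K : MKer D (F ⊕ F)} (hK : Spr K) : ∃ C δ : ℝ, 0 < δ ∧ 0 ≤ C ∧ Decays K C δ := by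
  obtain ⟨C, δ, hδ, h⟩ := hK
  exact ⟨|C|, δ, hδ, abs_nonneg C, decays_of_le h le_rfl⟩

/-- [folklore] Rows of every fibre of the sorted form of a spread pack are absolutely summable. -/
theorem hyp_rows [Fintype F] [NeZero n] {K : MKer D (F ⊕ F)} (hK : Spr K) :
    ∀ i j y, Summable fun y' => |Kfib (sortK n K) i j y y'| := by
  obtain ⟨C, δ, hδ, _, h⟩ := spr_decays_pos hK
  exact fun i j y => summable_abs_sortK h hδ i j y

/-- [folklore] Fibres of the sorted form of a block-covariant pack are jointly `p`-periodic. -/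
theorem hyp_per {K : MKer D (F ⊕ F)} (hKc : ∀ t : Fin D → ℤ, shiftK ((n : ℤ) • t) K = K) (p : ℕ) :
    ∀ i j, IsPeriodic₂ p (Kfib (sortK n K) i j) :=
  fun i j => isPeriodic₂_sortK hKc p i j

/-- [folklore] Fibres of the sorted form of a spread pack have a common row bound. -/
theorem hyp_bound [Fintype F] [NeZero n] {K : MKer D (F ⊕ F)} (hK : Spr K) :
    ∃ B : ℝ, ∀ i j, RowBound (Kfib (sortK n K) i j) B := by
  obtain ⟨C, δ, hδ, _, h⟩ := spr_decays_pos hK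
  exact ⟨C * Zl D δ, fun i j => rowBound_sortK h hδ i j⟩

/-! ## §2 The product rule for sorted packs on the coarse torus -/

section Product
variable [Fintype F] [NeZero n] {p : ℕ} [NeZero p]

/-- [folklore] **`(sortK (A ∘ K))^ = (sortK A)^ · (sortK K)^`** on every coarse torus, for spread packs `A`, `K` with `K` block covariant and
with multiplier rows vanishing off the coarse sublattice (`sortK_comp` + Q1's `periodiseF_compF_matrix`). -/
theorem periodise_sortK_comp {A K : MKer D (F ⊕ F)} (hA : Spr A) (hK : Spr K)
    (hKc : ∀ t : Fin D → ℤ, shiftK ((n : ℤ) • t) K = K) (hKo : ∀ y z f b, Torus.proj n y ≠ 0 → K y z (Sum.inr f) b = 0) :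
    Matrix.of (periodiseF p (sortK n (comp A K))) = Matrix.of (periodiseF p (sortK n A)) * Matrix.of (periodiseF p (sortK n K)) := by
  obtain ⟨B, hB⟩ := hyp_bound (n := n) hK
  rw [sortK_comp hA.tame hK.tame hKo]
  exact periodiseF_compF_matrix (hyp_rows hA) (hyp_per hKc p) hB

/-- [folklore] The triple product: `(sortK ((A ∘ M) ∘ K))^ = (sortK A)^ · (sortK M)^ · (sortK K)^`. -/
theorem periodise_sortK_comp₃ {A M K : MKer D (F ⊕ F)} (hA : Spr A) (hM : Spr M) (hK : Spr K)
    (hMc : ∀ t : Fin D → ℤ, shiftK ((n : ℤ) • t) M = M) (hKc : ∀ t : Fin D → ℤ, shiftK ((n : ℤ) • t) K = K)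
    (hMo : ∀ y z f b, Torus.proj n y ≠ 0 → M y z (Sum.inr f) b = 0) (hKo : ∀ y z f b, Torus.proj n y ≠ 0 → K y z (Sum.inr f) b = 0) :
    Matrix.of (periodiseF p (sortK n (comp (comp A M) K)))
      = Matrix.of (periodiseF p (sortK n A)) * Matrix.of (periodiseF p (sortK n M)) * Matrix.of (periodiseF p (sortK n K)) := by
  rw [periodise_sortK_comp (spr_comp hA hM) hK hKc hKo, periodise_sortK_comp hA hM hMc hMo]

end Product

/-! ## §3 The four relative-inverse rules on the torus -/

section Rules
variable [Fintype F] [NeZero n] {p : ℕ} [NeZero p]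

/-- [folklore] **THE RELATIVE-INVERSE RULES PERIODISE**: for spread packs `A`, `𝕄`, `E`, block covariant, with multiplier rows vanishing off
the coarse sublattice, `RelInv A 𝕄 E` on `ℤ^D` gives on every coarse torus `Site D p` the four matrix rules
`Ê·Â = Â`, `Â·Ê = Â`, `Â·𝕄̂·Ê = Ê`, `Ê·𝕄̂·Â = Ê` for `Â := (sortK n A)^` etc. -/
theorem torus_relInv_rules {A M E : MKer D (F ⊕ F)} (hrel : RelInv A M E) (hA : Spr A) (hM : Spr M) (hE : Spr E)
    (hAc : ∀ t : Fin D → ℤ, shiftK ((n : ℤ) • t) A = A) (hMc : ∀ t : Fin D → ℤ, shiftK ((n : ℤ) • t) M = M)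
    (hEc : ∀ t : Fin D → ℤ, shiftK ((n : ℤ) • t) E = E)
    (hAo : ∀ y z f b, Torus.proj n y ≠ 0 → A y z (Sum.inr f) b = 0) (hMo : ∀ y z f b, Torus.proj n y ≠ 0 → M y z (Sum.inr f) b = 0)
    (hEo : ∀ y z f b, Torus.proj n y ≠ 0 → E y z (Sum.inr f) b = 0) :
    Matrix.of (periodiseF p (sortK n E)) * Matrix.of (periodiseF p (sortK n A)) = Matrix.of (periodiseF p (sortK n A)) ∧
      Matrix.of (periodiseF p (sortK n A)) * Matrix.of (periodiseF p (sortK n E)) = Matrix.of (periodiseF p (sortK n A)) ∧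
      Matrix.of (periodiseF p (sortK n A)) * Matrix.of (periodiseF p (sortK n M)) * Matrix.of (periodiseF p (sortK n E))
        = Matrix.of (periodiseF p (sortK n E)) ∧
      Matrix.of (periodiseF p (sortK n E)) * Matrix.of (periodiseF p (sortK n M)) * Matrix.of (periodiseF p (sortK n A))
        = Matrix.of (periodiseF p (sortK n E)) := by
  refine ⟨?_, ?_, ?_, ?_⟩
  · rw [← periodise_sortK_comp hE hA hAc hAo, hrel.EA]
  · rw [← periodise_sortK_comp hA hE hEc hEo, hrel.AE]
  · rw [← periodise_sortK_comp₃ hA hM hE hMc hEc hMo hEo, hrel.AME]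
  · rw [← periodise_sortK_comp₃ hE hM hA hMc hAc hMo hAo, hrel.EMA]

/-- [folklore] The same four rules for the BLOCK matrices `blocksHat p (sortK n ·)` (`fromBlocks` of the periodised ff∕fm∕mf∕mm blocks, indexed by
`(Site D p × ((ℤ∕n)^D × F)) ⊕ (Site D p × F)` = fine bonds ⊕ coarse bonds — the index convention of `kkt`). -/
theorem torus_relInv_rules_blocks {A M E : MKer D (F ⊕ F)} (hrel : RelInv A M E) (hA : Spr A) (hM : Spr M) (hE : Spr E)
    (hAc : ∀ t : Fin D → ℤ, shiftK ((n : ℤ) • t) A = A) (hMc : ∀ t : Fin D → ℤ, shiftK ((n : ℤ) • t) M = M)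
    (hEc : ∀ t : Fin D → ℤ, shiftK ((n : ℤ) • t) E = E)
    (hAo : ∀ y z f b, Torus.proj n y ≠ 0 → A y z (Sum.inr f) b = 0) (hMo : ∀ y z f b, Torus.proj n y ≠ 0 → M y z (Sum.inr f) b = 0)
    (hEo : ∀ y z f b, Torus.proj n y ≠ 0 → E y z (Sum.inr f) b = 0) :
    blocksHat p (sortK n E) * blocksHat p (sortK n A) = blocksHat p (sortK n A) ∧
      blocksHat p (sortK n A) * blocksHat p (sortK n E) = blocksHat p (sortK n A) ∧
      blocksHat p (sortK n A) * blocksHat p (sortK n M) * blocksHat p (sortK n E) = blocksHat p (sortK n E) ∧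
      blocksHat p (sortK n E) * blocksHat p (sortK n M) * blocksHat p (sortK n A) = blocksHat p (sortK n E) := by
  obtain ⟨h1, h2, h3, h4⟩ := torus_relInv_rules (p := p) hrel hA hM hE hAc hMc hEc hAo hMo hEo
  simp only [blocksHat_eq_reindex, Matrix.reindex_apply]
  refine ⟨?_, ?_, ?_, ?_⟩
  · rw [Matrix.submatrix_mul_equiv, h1]
  · rw [Matrix.submatrix_mul_equiv, h2]
  · rw [Matrix.submatrix_mul_equiv, Matrix.submatrix_mul_equiv, h3]
  · rw [Matrix.submatrix_mul_equiv, Matrix.submatrix_mul_equiv, h4]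

end Rules

/-! ## §4 The wall's triple `(Π̂·KInv·Π̂ᵀ, bhK, axEc)` is admissible; its four rules on every coarse torus -/

section Covariance
variable {d : ℕ} {N : ℕ} [NeZero N]

/-- [folklore] The indicator 1-form of a translated bond is the translate of the indicator. -/
theorem delta1_add (l : Fin (d + 1)) (y v : Fin (d + 1) → ℤ) :
    delta1 l (y + v) = fun κ z => delta1 l y κ (z - v) := by
  funext κ z
  simp only [delta1_apply, sub_eq_iff_eq_add]

/-- [folklore] **THE UNDRESSED BORDERED HESSIAN IS BLOCK COVARIANT**: `shiftK (N • t) (bhK N) = bhK N`. -/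
theorem shiftK_bhK (t : Fin (d + 1) → ℤ) : shiftK ((N : ℤ) • t) (bhK (d := d) N) = bhK N := by
  funext x y a b
  simp only [ExpKernelCalculus.shiftK]
  rcases a with κ | κ <;> rcases b with l | l
  · rw [bhK_inl_inl, bhK_inl_inl, add_sub_add_right_eq_sub, delta1_add, KernelSpecInstance.opEL_shift, add_sub_cancel_right]
  · rw [bhK_inl_inr, bhK_inl_inr, proj_add_zsmul, SortedReblocking.quo_add_zsmul, delta1_add,
      KernelSpecInstance.contourSumAdj_shift, add_sub_cancel_right]
  · rw [bhK_inr_inl, bhK_inr_inl, proj_add_zsmul, SortedReblocking.quo_add_zsmul, delta1_add,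
      KernelSpecInstance.contourSum_shift, add_sub_cancel_right]
  · rw [bhK_inr_inr, bhK_inr_inr]

/-- [folklore] Comb-ness of a bond is invariant under block translations. -/
theorem isCombBondAt_add_zsmul (ρ : Fin (d + 1) → ℤ) (m : Fin (d + 1)) (x t : Fin (d + 1) → ℤ) :
    IsCombBondAt ρ N m (x + (N : ℤ) • t) ↔ IsCombBondAt ρ N m x := by
  have hq : ∀ z : Fin (d + 1) → ℤ, AveragingContours.blk N (z + (N : ℤ) • t) = AveragingContours.blk N z + t :=
    fun z => SortedReblocking.quo_add_zsmul z t
  unfold IsCombBondAt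
  rw [add_right_comm, hq, hq, add_left_inj]
  refine and_congr (forall_congr' fun j => imp_congr_right fun _ => ?_) Iff.rfl
  simp only [Pi.add_apply, Pi.smul_apply, smul_eq_mul, mul_add]
  constructor <;> intro h <;> linarith

open Classical in
/-- [folklore] **THE COARSE AXIAL COORDINATE PROJECTOR IS BLOCK COVARIANT**: `shiftK (N • t) (axEc ρ N) = axEc ρ N`. -/
theorem shiftK_axEc (ρ : Fin (d + 1) → ℤ) (t : Fin (d + 1) → ℤ) : shiftK ((N : ℤ) • t) (axEc ρ N) = axEc (d := d) ρ N := by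
  funext x y a b
  simp only [ExpKernelCalculus.shiftK]
  rcases a with α | m <;> rcases b with β | m'
  · rw [axEc_inl_inl, axEc_inl_inl, isCombBondAt_add_zsmul]
    simp only [add_left_inj]
  · rw [axEc_inl_inr, axEc_inl_inr]
  · rw [axEc_inr_inl, axEc_inr_inl]
  · rw [axEc_inr_inr, axEc_inr_inr, proj_add_zsmul]
    simp only [add_left_inj]

omit [NeZero N] in
open Classical in
/-- [folklore] Multiplier rows of `axEc` vanish off the coarse sublattice. -/
theorem axEc_inr_row_off (ρ : Fin (d + 1) → ℤ) {x : Fin (d + 1) → ℤ} (hx : Torus.proj N x ≠ 0) (y : Fin (d + 1) → ℤ) (m : Fin (d + 1))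
    (b : Fib d) : axEc ρ N x y (Sum.inr m) b = 0 := by
  rcases b with β | m'
  · exact axEc_inr_inl ρ N x y m β
  · rw [axEc_inr_inr, if_neg]
    exact fun h => hx h.2.2

end Covariance

section Wall
variable {d : ℕ} {n : ℕ} [NeZero n] {r : Fin (d + 1) → ℕ} (hr : r ∈ box (d + 1) n) (p : ℕ) [NeZero p]
include hr

/-- [folklore] **THE FOUR RULES ON THE TORUS FOR THE WALL'S TRIPLE** `(G, bhK n, axEc ρ n)`, `G := coDressKBmAt (toSite r) n (KInvStep n 0)`
(block matrices over the coarse torus `Site (d+1) p`). -/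
theorem torus_rules_wall :
    blocksHat p (sortK n (axEc (toSite r) n)) * blocksHat p (sortK n (coDressKBmAt (toSite r) n (KInvStep (d := d) n 0)))
        = blocksHat p (sortK n (coDressKBmAt (toSite r) n (KInvStep (d := d) n 0))) ∧
      blocksHat p (sortK n (coDressKBmAt (toSite r) n (KInvStep (d := d) n 0))) * blocksHat p (sortK n (axEc (toSite r) n))
        = blocksHat p (sortK n (coDressKBmAt (toSite r) n (KInvStep (d := d) n 0))) ∧
      blocksHat p (sortK n (coDressKBmAt (toSite r) n (KInvStep (d := d) n 0))) * blocksHat p (sortK n (bhK n))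
          * blocksHat p (sortK n (axEc (toSite r) n)) = blocksHat p (sortK n (axEc (toSite r) n)) ∧
      blocksHat p (sortK n (axEc (toSite r) n)) * blocksHat p (sortK n (bhK n))
          * blocksHat p (sortK n (coDressKBmAt (toSite r) n (KInvStep (d := d) n 0))) = blocksHat p (sortK n (axEc (toSite r) n)) :=
  torus_relInv_rules_blocks (p := p) (relInv_coDressKBmAt_KInvStep_zero hr)
    (spr_of_decays (decays_coDressKBmAt_KInvStep hr 0)) (spr_bhK (NeZero.one_le)) (spr_axEc _ _)
    (blockCov_of_neg fun t => shiftK_coDressKBmAt_KInvStep (toSite r) 0 t) (fun t => shiftK_bhK t) (fun t => shiftK_axEc _ t)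
    (fun _ z f b hy => coDressKBmAt_KInvStep_inr_row_off (toSite r) 0 hy z f b) (fun _ z f b hy => bhK_inr_row_off n hy z f b)
    (fun _ z f b hy => axEc_inr_row_off _ hy z f b)

end Wall

end Summit.QuantumFields.BalabanUV.Beta.D1BFx.SortedRelInv

end
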